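import Mathlib
import HarnessLib

/-!
# Zhang (2022) §15 (15.15): an open neighbourhood of Landau's closed rectangle on which the
# integrand of §15.u036 has only its four poles (isolated zero of `L(s,χ)` at `ρ̃`)

Topic `Literature/NumberTheory/LFunctions/Zhang2022` (Landau–Siegel audit tree; verdict-neutral).
Y. Zhang, *Discrete mean estimates and the Landau–Siegel zero*, arXiv:2211.02515v1 (2022)
[Zhang2022LandauSiegel] — **an unrefereed manuscript under adjudication**; nothing here is a claim of
the manuscript. Display (15.15) [Z22 p.85, tex L4218–4224] is proved "in a way similar to the proof of
Lemma 8.4", i.e. by the residue theorem on Landau's rectangle for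
`ζ(1+s+β₁)ζ(1+s+β₂)ℳ₁(d,l;1+s)ζ(1+s)⁻¹L(1+s,χ)⁻¹·(P₄/d)^{s+β₃}ω₁(s+β₃)/(s+β₃)`. The tree's contour
core `Eq1515.core_of_open` (`Section15BEq1515Core`, zl-w15-p1) asks for an OPEN set `U` containing
the closed rectangle `[a,1] × [−H,H]` on which `ζ₁(1+z) ≠ 0`, `Re(1+z) > 9/10` and `L(1+z,χ) ≠ 0` off
`z = ρ̃ − 1`, while the zero-free inputs of the manuscript (Lemma 5.5 / MV Thm 11.4, packaged in
`Section15BEq1515PhiBounds`) are stated on CLOSED regions whose boundary carries the left side of the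
rectangle. THIS FILE manufactures `U` from the closed data (`exists_open_nbhd_rect`): the only
non-trivial point is the simple zero `ρ̃` INSIDE the rectangle, handled by the isolated-zeros
principle for the entire function `L(·,χ)` (`AnalyticAt.eventually_eq_zero_or_eventually_ne_zero`;
`L′(ρ̃,χ) ≠ 0` rules out the identically-zero branch); then
`U := {Re(1+z) > 9/10} ∩ {ζ₁(1+z) ≠ 0} ∩ ({L(1+z,χ) ≠ 0} ∪ B(ρ̃−1, δ))` is open by continuity and
contains the rectangle. Pure complex analysis; helper under leaf h15_17 (`Typed.Section15B.Eq15_17`)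
for the (15.15)W assembly. Theorems only; standard axioms. Nothing about Landau–Siegel zeros or the
manuscript's Theorems 1–2 is asserted.

## References
* Y. Zhang, arXiv:2211.02515v1 (2022), §15 (15.15)–(15.16) p.85. [cite: Zhang2022LandauSiegel, §15 (15.15)]
* J. B. Conway, *Functions of One Complex Variable I*, GTM 11, Ch. IV Thm 3.7 (isolated zeros). [Conway1978]
-/

noncomputable section

open Complex Real Set Filter Topology Metric

namespace Literature.NumberTheory.LFunctions.Zhang2022.Eq1515

variable {D : ℕ} [NeZero D] (χ : DirichletCharacter ℂ D)

/-- **Isolated zero of `L(·,χ)` at a simple zero**: if `L′(ρ,χ) ≠ 0` then on some punctured ball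
around `ρ − 1` the function `z ↦ L(1+z,χ)` does not vanish (`χ ≠ χ₀`, so `L(·,χ)` is entire).
[cite: Zhang2022LandauSiegel, §15 (15.15) p.85] -/
theorem exists_ball_LFunction_ne_zero (hχ1 : χ ≠ 1) {ρ : ℝ} (hρL' : deriv χ.LFunction ρ ≠ 0) :
    ∃ δ : ℝ, 0 < δ ∧ ∀ z : ℂ, dist z ((ρ - 1 : ℝ) : ℂ) < δ → z ≠ ((ρ - 1 : ℝ) : ℂ) →
      χ.LFunction (1 + z) ≠ 0 := by
  set f : ℂ → ℂ := fun z => χ.LFunction (1 + z) with hf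
  have hdiffL := DirichletCharacter.differentiable_LFunction hχ1
  have hdiff : Differentiable ℂ f := by
    rw [hf]
    exact hdiffL.comp ((differentiable_const (1 : ℂ)).add differentiable_id)
  have han : AnalyticAt ℂ f ((ρ - 1 : ℝ) : ℂ) := hdiff.analyticAt _
  have h1ρ : (1 : ℂ) + ((ρ - 1 : ℝ) : ℂ) = (ρ : ℂ) := by push_cast; ring
  rcases han.eventually_eq_zero_or_eventually_ne_zero with h0 | hne
  · -- identically zero near `ρ − 1` ⇒ `L′(ρ,χ) = 0`: contradiction
    exfalso
    apply hρL'
    have hd : deriv f ((ρ - 1 : ℝ) : ℂ) = 0 := by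
      rw [Filter.EventuallyEq.deriv_eq h0]
      simp
    have hchain : deriv f ((ρ - 1 : ℝ) : ℂ) = deriv χ.LFunction (ρ : ℂ) := by
      rw [hf, deriv_comp_const_add, h1ρ]
    rw [← hchain, hd]
  · have hne' : ∀ᶠ z in 𝓝 (((ρ - 1 : ℝ) : ℂ)), z ∈ ({((ρ - 1 : ℝ) : ℂ)}ᶜ : Set ℂ) → f z ≠ 0 :=
      eventually_nhdsWithin_iff.mp hne
    obtain ⟨δ, hδ, hball⟩ := Metric.eventually_nhds_iff.mp hne'
    refine ⟨δ, hδ, fun z hz hzρ => ?_⟩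
    exact hball hz hzρ

/-- **An open neighbourhood of Landau's closed rectangle with only the four poles.** If `a > −1/10`,
`ζ₁(1+z) ≠ 0` on the closed rectangle `[a,1] × [−H,H]` and `L(1+z,χ) ≠ 0` there off `z = ρ − 1`
(`ρ` a simple zero: `L′(ρ,χ) ≠ 0`; `χ ≠ χ₀`), then some OPEN `U ⊇ [a,1] × [−H,H]` has `ζ₁(1+z) ≠ 0`,
`Re(1+z) > 9/10` and (`z ≠ ρ−1` ⇒ `L(1+z,χ) ≠ 0`) for all `z ∈ U` — the shape consumed by
`Eq1515.core_of_open`. [cite: Zhang2022LandauSiegel, §15 (15.15)–(15.16) p.85] -/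
theorem exists_open_nbhd_rect (hχ1 : χ ≠ 1) {a H ρ : ℝ} (ha : -(1 / 10 : ℝ) < a)
    (hρL' : deriv χ.LFunction ρ ≠ 0)
    (hζK : ∀ z ∈ Icc a 1 ×ℂ Icc (-H) H, riemannZeta₁ (1 + z) ≠ 0)
    (hLK : ∀ z ∈ Icc a 1 ×ℂ Icc (-H) H, z ≠ ((ρ - 1 : ℝ) : ℂ) → χ.LFunction (1 + z) ≠ 0) :
    ∃ U : Set ℂ, IsOpen U ∧ Icc a 1 ×ℂ Icc (-H) H ⊆ U ∧
      (∀ z ∈ U, riemannZeta₁ (1 + z) ≠ 0) ∧ (∀ z ∈ U, 9 / 10 < (1 + z).re) ∧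
      (∀ z ∈ U, z ≠ ((ρ - 1 : ℝ) : ℂ) → χ.LFunction (1 + z) ≠ 0) := by
  obtain ⟨δ, hδ, hball⟩ := exists_ball_LFunction_ne_zero χ hχ1 hρL'
  set p : ℂ := ((ρ - 1 : ℝ) : ℂ) with hp
  set U : Set ℂ := {z : ℂ | 9 / 10 < (1 + z).re} ∩ {z : ℂ | riemannZeta₁ (1 + z) ≠ 0} ∩
    ({z : ℂ | χ.LFunction (1 + z) ≠ 0} ∪ Metric.ball p δ) with hU
  -- continuity of the three functions of `z`
  have hre : Continuous fun z : ℂ => (1 + z).re := Complex.continuous_re.comp (by fun_prop)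
  have hζc : Continuous fun z : ℂ => riemannZeta₁ (1 + z) :=
    differentiable_riemannZeta₁.continuous.comp (by fun_prop)
  have hLc : Continuous fun z : ℂ => χ.LFunction (1 + z) :=
    (DirichletCharacter.differentiable_LFunction hχ1).continuous.comp (by fun_prop)
  have hUopen : IsOpen U := by
    rw [hU]
    refine ((isOpen_lt continuous_const hre).inter (isOpen_ne_fun hζc continuous_const)).inter ?_
    exact (isOpen_ne_fun hLc continuous_const).union Metric.isOpen_ball
  refine ⟨U, hUopen, ?_, ?_, ?_, ?_⟩
  · -- the rectangle lies in `U`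
    intro z hz
    have hzre : a ≤ z.re := (Complex.mem_reProdIm.mp hz).1.1
    rw [hU]
    refine ⟨⟨?_, hζK z hz⟩, ?_⟩
    · show 9 / 10 < (1 + z).re
      simp only [Complex.add_re, Complex.one_re]
      linarith
    · by_cases hzp : z = p
      · right
        rw [hzp]
        exact Metric.mem_ball_self hδ
      · left
        exact hLK z hz hzp
  · intro z hz
    rw [hU] at hz
    exact hz.1.2
  · intro z hz
    rw [hU] at hz
    exact hz.1.1
  · intro z hz hzp
    rw [hU] at hz
    rcases hz.2 with h | h
    · exact h
    · exact hball z (Metric.mem_ball.mp h) hzp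

end Literature.NumberTheory.LFunctions.Zhang2022.Eq1515
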